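import Literature.Computability.AlgebraicComplexity.HomogeneousComponentsComplexity
import Literature.Computability.AlgebraicComplexity.SignConstantGateLists
import HarnessLib

/-!
# Homogeneous components are constant-free cheap: `τ(f^{(d)}) ≤ (d + 2)² · τ(f)`

Bürgisser–Clausen–Shokrollahi, *Algebraic Complexity Theory* (1997), §21.2, Lemma (21.25)
(p. 550): the homogeneous parts of degree `≤ d` of every result of a straight-line program of
length `L` are computed by a straight-line program of length `≤ (d + 1)² · L`, gate by gate
(`(v + w)^{(e)} = v^{(e)} + w^{(e)}`, Cauchy product `(v w)^{(e)} = Σ_{l ≤ e} v^{(l)} w^{(e-l)}`),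
"and the constants are free".  `HomogeneousComponentsComplexity.lean` does this for the tree's
`complexity` (arbitrary constants).  THIS file records the observation, implicit in the printed
proof and standard in the constant-free literature (Malod 2003; Bürgisser 2009, §2.2: `VP⁰` is
closed under homogeneous components), that the pass INTRODUCES NO NEW CONSTANTS: if the given
circuit has sign constants (`ArithCircuit.HasSignConstants`: constant operands and sum
coefficients in `{0, 1, -1}`), so does the homogenised one — every new gate is a product of two
available operands or a weighted sum `a • v^{(e)} + b • w^{(e)}` with the SAME coefficients as
the old gate `a • v + b • w`, and the only constant operands introduced are `0`, `1` and those of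
the old circuit.  Results (all proved; no definitions, no named facts):

* `ArithCircuit.exists_hasSignConstants_computes_homogeneousComponent` — from a fan-in-two
  circuit `P` with sign constants and `d`: a fan-in-two `Q` with sign constants,
  `Q.eval = homogeneousComponent d P.eval`, `Q.size ≤ (d + 2)² · P.size`;
* `constantFreeComplexity_homogeneousComponent_le` — **`τ(f^{(d)}) ≤ (d + 2)² · τ(f)`** over `ℤ`.

Bookkeeping: the sign-constant gate-list plumbing `SignConstantGateLists.lean` (`CFGates.*`),
availability witnessed by a sign-constant operand.  Use: summit ValiantsHypothesis, route
AnyonJets (the jets are homogeneous components of the shifted inversion pencil;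
`Theorems/AnyonJetsJetConstantElimVP0Collapse.lean`).  Honest framing: routine bookkeeping on a
textbook lemma; `VP ≠ VNP` is NOT proved here.

## References

* [BurgisserClausenShokrollahi1997] P. Bürgisser, M. Clausen, M. A. Shokrollahi, *Algebraic
  Complexity Theory*, Springer 1997, §21.2, Lemma (21.25) and its proof (p. 550).
* [Burgisser2009] P. Bürgisser, *On defining integers and proving arithmetic circuit lower
  bounds*, Comput. Complexity 18 (2009), §2.2 (`τ`, `VP⁰`).
* [Burgisser2000] P. Bürgisser, *Completeness and Reduction in Algebraic Complexity Theory*,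
  Springer 2000, §1.4 (constant-free computations), Def. 2.1 (the circuit model).
-/

noncomputable section

namespace Literature.Computability.AlgebraicComplexity

open MvPolynomial

universe u v

namespace ArithCircuit

variable {k : Type u} [CommSemiring k] {σ : Type v}

namespace CFHomogenisation

open CFGates

/-! ### The homogenisation pass with sign constants

`d` is the top degree wanted; "the components of `v` are available in `gs`" means that every
`homogeneousComponent e v`, `e ≤ d`, is available with a sign-constant witness. -/

/-- An available HOMOGENEOUS polynomial has all its components available: itself in its own
degree, the constant operand `0` elsewhere.
[cite: BurgisserClausenShokrollahi1997, Lemma (21.25)] -/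
theorem hc_of_isHomogeneous (gs : List (Gate k σ)) (d : ℕ) {p : MvPolynomial σ k} {m : ℕ}
    (hm : p.IsHomogeneous m)
    (hp : ∃ u : Operand k σ, u.RefsBelow gs.length ∧ u.HasSignConstants ∧
      u.eval (gateValues gs) = p) :
    ∀ e ≤ d, ∃ u : Operand k σ, u.RefsBelow gs.length ∧ u.HasSignConstants ∧
      u.eval (gateValues gs) = homogeneousComponent e p := by
  intro e _
  rw [homogeneousComponent_of_mem hm]
  split_ifs
  · exact hp
  · simpa using avail_C gs (isSignConstant_zero (k := k))

/-- The components of `0` are the constant operand `0`.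
[cite: BurgisserClausenShokrollahi1997, Lemma (21.25)] -/
theorem hc_zero (gs : List (Gate k σ)) (d : ℕ) :
    ∀ e ≤ d, ∃ u : Operand k σ, u.RefsBelow gs.length ∧ u.HasSignConstants ∧
      u.eval (gateValues gs) = homogeneousComponent e (0 : MvPolynomial σ k) :=
  fun e _ => by simpa using avail_C gs (isSignConstant_zero (k := k))

/-- Operands of the old circuit (with sign constants): if the components of all earlier gate
values are available, so are those of the value of the operand — a variable (homogeneous of
degree `1`), a sign constant (degree `0`; "the constants are free"), or a gate reference (junk
references read `0`). [cite: BurgisserClausenShokrollahi1997, Lemma (21.25)] -/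
theorem hc_operand (gs : List (Gate k σ)) (d : ℕ) (vals : List (MvPolynomial σ k))
    (hvals : ∀ v ∈ vals, ∀ e ≤ d, ∃ u : Operand k σ, u.RefsBelow gs.length ∧
      u.HasSignConstants ∧ u.eval (gateValues gs) = homogeneousComponent e v)
    (u : Operand k σ) (hu : u.HasSignConstants) :
    ∀ e ≤ d, ∃ u' : Operand k σ, u'.RefsBelow gs.length ∧ u'.HasSignConstants ∧
      u'.eval (gateValues gs) = homogeneousComponent e (u.eval vals) := by
  cases u with
  | var i => exact hc_of_isHomogeneous gs d (isHomogeneous_X k i) (avail_X gs i)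
  | const c =>
    exact hc_of_isHomogeneous gs d (isHomogeneous_C σ c)
      (avail_C gs ((Operand.hasSignConstants_const_iff c).1 hu))
  | gate j =>
    simp only [Operand.eval, List.getD_eq_getElem?_getD]
    cases hj : vals[j]? with
    | none => exact hc_zero gs d
    | some v => exact hvals v (List.mem_of_getElem? hj)

/-- Weighted sums KEEP their coefficients: `(a • v + b • w)^{(e)} = a • v^{(e)} + b • w^{(e)}`,
one sum gate with the same sign coefficients `a, b` per degree, `d + 1` new gates.
[cite: BurgisserClausenShokrollahi1997, Lemma (21.25)] -/
theorem hc_wsum {gs : List (Gate k σ)} (hgs : ∀ g ∈ gs, g.fanIn ≤ 2 ∧ g.HasSignConstants)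
    {d : ℕ} {a b : k} (ha : IsSignConstant a) (hb : IsSignConstant b) {v w : MvPolynomial σ k}
    (hv : ∀ e ≤ d, ∃ u : Operand k σ, u.RefsBelow gs.length ∧ u.HasSignConstants ∧
      u.eval (gateValues gs) = homogeneousComponent e v)
    (hw : ∀ e ≤ d, ∃ u : Operand k σ, u.RefsBelow gs.length ∧ u.HasSignConstants ∧
      u.eval (gateValues gs) = homogeneousComponent e w) :
    ∃ gs' : List (Gate k σ), gs <+: gs' ∧ (∀ g ∈ gs', g.fanIn ≤ 2 ∧ g.HasSignConstants) ∧
      gs'.length ≤ gs.length + (d + 1) ∧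
      ∀ e ≤ d, ∃ u : Operand k σ, u.RefsBelow gs'.length ∧ u.HasSignConstants ∧
        u.eval (gateValues gs') = homogeneousComponent e (a • v + b • w) := by
  obtain ⟨gs', hpre, hgood, hlen, hall⟩ := iterate_extend
    (Q := fun e gs' => ∃ u : Operand k σ, u.RefsBelow gs'.length ∧ u.HasSignConstants ∧
        u.eval (gateValues gs') = homogeneousComponent e (a • v + b • w))
    (fun _ _ _ h hQ => avail_mono h hQ) 1 gs hgs (d + 1) (by
      intro e he gs' hp hg _
      obtain ⟨gs'', hp'', hg'', hl'', hu⟩ := extend_wsum hg ha hb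
        (avail_mono hp (hv e (by omega))) (avail_mono hp (hw e (by omega)))
      refine ⟨gs'', hp'', hg'', hl'', ?_⟩
      rw [map_add, LinearMap.map_smul_of_tower, LinearMap.map_smul_of_tower]
      exact hu)
  exact ⟨gs', hpre, hgood, by omega, fun e he => hall e (Nat.lt_succ_of_le he)⟩

/-- Products: the Cauchy product `(v w)^{(e)} = Σ_{l ≤ e} v^{(l)} w^{(e-l)}`, `e + 1` products and
`e + 1` coefficient-`1` additions for degree `e`, hence `(d + 1)(d + 2)` new gates for all
degrees `≤ d`. [cite: BurgisserClausenShokrollahi1997, Lemma (21.25)] -/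
theorem hc_mul {gs : List (Gate k σ)} (hgs : ∀ g ∈ gs, g.fanIn ≤ 2 ∧ g.HasSignConstants) {d : ℕ}
    {v w : MvPolynomial σ k}
    (hv : ∀ e ≤ d, ∃ u : Operand k σ, u.RefsBelow gs.length ∧ u.HasSignConstants ∧
      u.eval (gateValues gs) = homogeneousComponent e v)
    (hw : ∀ e ≤ d, ∃ u : Operand k σ, u.RefsBelow gs.length ∧ u.HasSignConstants ∧
      u.eval (gateValues gs) = homogeneousComponent e w) :
    ∃ gs' : List (Gate k σ), gs <+: gs' ∧ (∀ g ∈ gs', g.fanIn ≤ 2 ∧ g.HasSignConstants) ∧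
      gs'.length ≤ gs.length + (d + 1) * (d + 2) ∧
      ∀ e ≤ d, ∃ u : Operand k σ, u.RefsBelow gs'.length ∧ u.HasSignConstants ∧
        u.eval (gateValues gs') = homogeneousComponent e (v * w) := by
  have key : ∀ m : ℕ, m ≤ d + 1 →
      ∃ gs' : List (Gate k σ), gs <+: gs' ∧ (∀ g ∈ gs', g.fanIn ≤ 2 ∧ g.HasSignConstants) ∧
        gs'.length ≤ gs.length + m * (m + 1) ∧
        ∀ e < m, ∃ u : Operand k σ, u.RefsBelow gs'.length ∧ u.HasSignConstants ∧
          u.eval (gateValues gs') = homogeneousComponent e (v * w) := by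
    intro m
    induction m with
    | zero =>
      intro _
      exact ⟨gs, List.prefix_rfl, hgs, by simp, fun e he => absurd he (Nat.not_lt_zero e)⟩
    | succ m ih =>
      intro hm
      obtain ⟨gs₁, hp₁, hg₁, hl₁, hQ₁⟩ := ih (Nat.le_of_succ_le hm)
      obtain ⟨gs₂, hp₂, hg₂, hl₂, hu₂⟩ := avail_sum_range
        (fun l => homogeneousComponent l v * homogeneousComponent (m - l) w) 1 gs₁ hg₁ (m + 1) (by
          intro l hl gs' hp' hg'
          have hp₀ : gs <+: gs' := hp₁.trans hp'
          exact extend_mul hg' (avail_mono hp₀ (hv l (by omega)))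
            (avail_mono hp₀ (hw (m - l) (by omega))))
      refine ⟨gs₂, hp₁.trans hp₂, hg₂, ?_, ?_⟩
      · calc gs₂.length ≤ gs₁.length + (1 + 1) * (m + 1) := hl₂
          _ ≤ gs.length + m * (m + 1) + (1 + 1) * (m + 1) := Nat.add_le_add_right hl₁ _
          _ = gs.length + (m + 1) * (m + 1 + 1) := by ring
      · intro e he
        rcases Nat.lt_succ_iff_lt_or_eq.mp he with he | rfl
        · exact avail_mono hp₂ (hQ₁ e he)
        · rw [DepthReduction.homogeneousComponent_mul]
          exact hu₂
  obtain ⟨gs', hp, hg, hl, hQ⟩ := key (d + 1) le_rfl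
  refine ⟨gs', hp, hg, hl.trans (le_of_eq (by ring)), fun e he => hQ e (Nat.lt_succ_of_le he)⟩

/-- One old gate (fan-in `≤ 2`, sign constants): at most `(d + 2)²` new fan-in-two gates with
sign constants make all components of degree `≤ d` of its value available (`d + 1` for a
weighted sum, `(d + 1)(d + 2)` for a product).
[cite: BurgisserClausenShokrollahi1997, Lemma (21.25)] -/
theorem hc_gate {gs : List (Gate k σ)} (hgs : ∀ g ∈ gs, g.fanIn ≤ 2 ∧ g.HasSignConstants) {d : ℕ}
    (vals : List (MvPolynomial σ k))
    (hvals : ∀ v ∈ vals, ∀ e ≤ d, ∃ u : Operand k σ, u.RefsBelow gs.length ∧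
      u.HasSignConstants ∧ u.eval (gateValues gs) = homogeneousComponent e v)
    (g : Gate k σ) (hg : g.fanIn ≤ 2) (hsg : g.HasSignConstants) :
    ∃ gs' : List (Gate k σ), gs <+: gs' ∧ (∀ g ∈ gs', g.fanIn ≤ 2 ∧ g.HasSignConstants) ∧
      gs'.length ≤ gs.length + (d + 2) ^ 2 ∧
      ∀ e ≤ d, ∃ u : Operand k σ, u.RefsBelow gs'.length ∧ u.HasSignConstants ∧
        u.eval (gateValues gs') = homogeneousComponent e (g.eval vals) := by
  have hsq : (d + 2) ^ 2 = (d + 1) * (d + 2) + (d + 2) := by ring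
  have hb1 : d + 1 ≤ (d + 2) ^ 2 := by rw [hsq]; nlinarith
  have hbm : (d + 1) * (d + 2) ≤ (d + 2) ^ 2 := by rw [hsq]; exact Nat.le_add_right _ _
  have h0 : gs.length ≤ gs.length + (d + 2) ^ 2 := Nat.le_add_right _ _
  cases g with
  | sum args =>
    match args, hg, hsg with
    | [], _, _ =>
      refine ⟨gs, List.prefix_rfl, hgs, h0, ?_⟩
      rw [show (Gate.sum ([] : List (k × Operand k σ))).eval vals = 0 by simp [Gate.eval]]
      exact hc_zero gs d
    | [a], _, hsg =>
      have ha : IsSignConstant a.1 ∧ a.2.HasSignConstants := hsg a (by simp)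
      obtain ⟨gs₁, hp₁, hg₁, hl₁, hr₁⟩ := hc_wsum hgs ha.1 (isSignConstant_zero (k := k))
        (hc_operand gs d vals hvals a.2 ha.2) (hc_operand gs d vals hvals a.2 ha.2)
      refine ⟨gs₁, hp₁, hg₁, hl₁.trans (Nat.add_le_add_left hb1 _), ?_⟩
      rw [show (Gate.sum [a]).eval vals = a.1 • a.2.eval vals + (0 : k) • a.2.eval vals by
        simp [Gate.eval]]
      exact hr₁
    | [a, b], _, hsg =>
      have ha : IsSignConstant a.1 ∧ a.2.HasSignConstants := hsg a (by simp)
      have hb : IsSignConstant b.1 ∧ b.2.HasSignConstants := hsg b (by simp)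
      obtain ⟨gs₁, hp₁, hg₁, hl₁, hr₁⟩ := hc_wsum hgs ha.1 hb.1
        (hc_operand gs d vals hvals a.2 ha.2) (hc_operand gs d vals hvals b.2 hb.2)
      refine ⟨gs₁, hp₁, hg₁, hl₁.trans (Nat.add_le_add_left hb1 _), ?_⟩
      rw [show (Gate.sum [a, b]).eval vals = a.1 • a.2.eval vals + b.1 • b.2.eval vals by
        simp [Gate.eval]]
      exact hr₁
    | _ :: _ :: _ :: _, hg, _ => simp [Gate.fanIn, Gate.args] at hg
  | prod args =>
    match args, hg, hsg with
    | [], _, _ =>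
      refine ⟨gs, List.prefix_rfl, hgs, h0, ?_⟩
      rw [show (Gate.prod ([] : List (Operand k σ))).eval vals = C 1 by simp [Gate.eval]]
      exact hc_of_isHomogeneous gs d (isHomogeneous_C σ (1 : k))
        (avail_C gs (isSignConstant_one (k := k)))
    | [u], _, hsg =>
      refine ⟨gs, List.prefix_rfl, hgs, h0, ?_⟩
      rw [show (Gate.prod [u]).eval vals = u.eval vals by simp [Gate.eval]]
      exact hc_operand gs d vals hvals u (hsg u (by simp))
    | [u, w], _, hsg =>
      obtain ⟨gs₁, hp₁, hg₁, hl₁, hr₁⟩ :=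
        hc_mul hgs (hc_operand gs d vals hvals u (hsg u (by simp)))
          (hc_operand gs d vals hvals w (hsg w (by simp)))
      refine ⟨gs₁, hp₁, hg₁, hl₁.trans (Nat.add_le_add_left hbm _), ?_⟩
      rw [show (Gate.prod [u, w]).eval vals = u.eval vals * w.eval vals by simp [Gate.eval]]
      exact hr₁
    | _ :: _ :: _ :: _, hg, _ => simp [Gate.fanIn, Gate.args] at hg

/-- **The constant-free homogenisation pass** (BCS Lemma (21.25), "the constants are free"):
for a list `cs` of fan-in-two gates with sign constants there is a list of at most
`(d + 2)² · |cs|` fan-in-two gates with sign constants in which every component of degree `≤ d`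
of every value of `cs` is available. [cite: BurgisserClausenShokrollahi1997, Lemma (21.25)] -/
theorem hc_gates {d : ℕ} (cs : List (Gate k σ))
    (hcs : ∀ g ∈ cs, g.fanIn ≤ 2 ∧ g.HasSignConstants) :
    ∃ gs' : List (Gate k σ), (∀ g ∈ gs', g.fanIn ≤ 2 ∧ g.HasSignConstants) ∧
      gs'.length ≤ (d + 2) ^ 2 * cs.length ∧
      ∀ v ∈ gateValues cs, ∀ e ≤ d, ∃ u : Operand k σ, u.RefsBelow gs'.length ∧
        u.HasSignConstants ∧ u.eval (gateValues gs') = homogeneousComponent e v := by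
  induction cs using List.reverseRecOn with
  | nil => exact ⟨[], by simp, by simp, fun v hv => by simp [gateValues] at hv⟩
  | append_singleton cs g ih =>
    obtain ⟨gs₁, hg₁, hl₁, hr₁⟩ := ih (fun g' hg' => hcs g' (by simp [hg']))
    have hgc := hcs g (by simp)
    obtain ⟨gs₂, hp₂, hg₂, hl₂, hr₂⟩ := hc_gate hg₁ (gateValues cs) hr₁ g hgc.1 hgc.2
    refine ⟨gs₂, hg₂, ?_, ?_⟩
    · calc gs₂.length ≤ gs₁.length + (d + 2) ^ 2 := hl₂
        _ ≤ (d + 2) ^ 2 * cs.length + (d + 2) ^ 2 := Nat.add_le_add_right hl₁ _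
        _ = (d + 2) ^ 2 * (cs ++ [g]).length := by simp [Nat.mul_succ]
    · intro v hv
      rw [gateValues_append_singleton, List.mem_append, List.mem_singleton] at hv
      rcases hv with hv | rfl
      · exact fun e he => avail_mono hp₂ (hr₁ v hv e he)
      · exact hr₂

end CFHomogenisation

/-- **Constant-free homogenisation of a fan-in-two circuit.** For every fan-in-two circuit `P`
with sign constants (all constant operands and sum coefficients in `{0, 1, -1}`) and every `d`
there is a fan-in-two circuit `Q` WITH SIGN CONSTANTS computing the degree-`d` homogeneous
component of `P.eval`, of size at most `(d + 2)² · P.size` (BCS Lemma (21.25): the pass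
introduces no constants beyond `0`, `1` and those of `P`).
[cite: BurgisserClausenShokrollahi1997, Lemma (21.25)] -/
theorem exists_hasSignConstants_computes_homogeneousComponent (P : ArithCircuit k σ)
    (hP : P.IsFanInTwo) (hS : P.HasSignConstants) (d : ℕ) :
    ∃ Q : ArithCircuit k σ, Q.IsFanInTwo ∧ Q.HasSignConstants ∧
      Q.eval = homogeneousComponent d P.eval ∧ Q.size ≤ (d + 2) ^ 2 * P.size := by
  obtain ⟨gs, hgood, hlen, hrepr⟩ :=
    CFHomogenisation.hc_gates (d := d) P.gates fun g hg => ⟨hP g hg, hS.1 g hg⟩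
  obtain ⟨u, -, hus, hu⟩ := CFHomogenisation.hc_operand gs d (gateValues P.gates) hrepr
    P.output hS.2 d le_rfl
  exact ⟨⟨gs, u⟩, fun g hg => (hgood g hg).1, ⟨fun g hg => (hgood g hg).2, hus⟩, hu, hlen⟩

end ArithCircuit

section Complexity

open ArithCircuit

variable {σ : Type v}

/-- **`τ(f^{(d)}) ≤ (d + 2)² · τ(f)`** — Bürgisser's constant-free complexity is closed under
taking homogeneous components at quadratic cost in the degree (BCS 1997, Lemma (21.25) read in
the constant-free model of Bürgisser 2009, §2.2 / Malod 2003: homogenise a `τ`-optimal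
constant-free circuit, `ArithCircuit.exists_computes_size_eq_constantFreeComplexity` and
`ArithCircuit.exists_hasSignConstants_computes_homogeneousComponent`). No interpolation, hence
no division and no large constants. [cite: BurgisserClausenShokrollahi1997, Lemma (21.25)] -/
theorem constantFreeComplexity_homogeneousComponent_le (f : MvPolynomial σ ℤ) (d : ℕ) :
    constantFreeComplexity (homogeneousComponent d f) ≤
      (d + 2) ^ 2 * constantFreeComplexity f := by
  obtain ⟨P, h2, hs, hf, hsz⟩ := ArithCircuit.exists_computes_size_eq_constantFreeComplexity f
  obtain ⟨Q, hQ2, hQs, hQf, hQsz⟩ :=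
    P.exists_hasSignConstants_computes_homogeneousComponent h2 hs d
  have hPf : P.eval = f := hf
  have hQc : Q.Computes (homogeneousComponent d f) := by
    show Q.eval = homogeneousComponent d f
    rw [hQf, hPf]
  calc constantFreeComplexity (homogeneousComponent d f) ≤ Q.size :=
      ArithCircuit.constantFreeComplexity_le_size hQ2 hQs hQc
    _ ≤ (d + 2) ^ 2 * P.size := hQsz
    _ = (d + 2) ^ 2 * constantFreeComplexity f := by rw [hsz]

end Complexity

end Literature.Computability.AlgebraicComplexity

end
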